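/-
Origin: expansion seat `literature-prover-pub-hodgecm-cf-kudla-howe-rallis-g2-0`, handover #4 2026-08-18T05:17:09Z (`HOME/pub-hodgecm-cf-kudla-howe-rallis-g2/SeesawSplittingSmoke.lean`, md5 5b4135ff, 227 lines);
landed by the gen-6 packager in gate run 22 as `HodgeCM/Automorphic/SeesawSplittingSmoke.lean` (verbatim).
-/
/-
Origin: HOME/pub-hodgecm-cf-kudla-howe-rallis-g2/SeesawSplittingSmoke.lean — session
literature-prover-pub-hodgecm-cf-kudla-howe-rallis-g2-0 (unit pub-hodgecm-cf-kudla-howe-rallis-g2, CITED-FACT seat (4) gen 2).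
NON-VACUITY GUARD (nothing cited, nothing consumed; delete freely): the hypotheses of the derivation chain
`SeesawCover.pending_GUsideCompatible_of_doubledModel` → `splittingsCompatible_of` → `of_parts`
(`HodgeCM/Automorphic/SeesawSplittingModel.lean`, `HodgeCM/Automorphic/ThetaPending.lean` §1) are JOINTLY SATISFIABLE
on a model whose `G_U`-side splitting characters are NON-TRIVIAL and MULTIPLY.  Intended place:
`HodgeCM/Automorphic/SeesawSplittingSmoke.lean` (imports `HodgeCM.Automorphic.SeesawSplittingModel` only).
-/
import Summits.HodgeConjecture.HodgeCM.Automorphic.SeesawSplittingModel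

set_option autoImplicit false

/-!
# Smoke model for the seesaw splitting derivation (vacuity guard)

The SCALAR MODEL of [HKS96, (1.12)–(1.19)]: the three symplectic groups are trivial, the three standard models
are `ℂ` with `e = lid : ℂ ⊗ ℂ ≃ ℂ` and `r = 1`, so the doubled operator groups are the scalars `ℂˣ` — the central
`ℂ¹ ⊂ ℂˣ` of (1.12) and nothing else; the three un-doubled covers `Mp(𝕎₁), Mp(𝕎₂), Mp(𝕎)` are `ℂˣ` with Kudla's
`j̃(z₁, z₂) = z₁ z₂` ((1.18)); `G_U = ℂˣ` and the HKS splitting data have `x = id`, `j = 0`, `χ_{P₁} = χ_{P₂} = id`,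
so `β_{P_j}(h) = h` and `β_{P₁ ⊕ P₂}(h) = h²` — "the `G_U`-side characters multiply".  Every field of
`GUsideDoubledDatum`, `SeesawCover.DoubledModel` (including the PRINT-DERIVED `jt_compat`), `IotaDiag`,
`StandardModelTensor`, `IsPullback`, `SplittingRestricts`, Kudla's `hKu` and the kernel factorisation `hθ` holds
in this model, and the chain fires: `smoke_pending_GUsideCompatible`, `smoke_unitaryWeilRepMultiplicative`.
This shows the derivation is not vacuous; it says nothing about PerL's actual covers.
-/

noncomputable section

namespace HodgeCM.Automorphic.ThetaPending.SeesawSmoke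

open HodgeCM.Literature.Theta TensorProduct

/-- `z ↦ z · id_ℂ` as a homomorphism `ℂˣ →* GL₁(ℂ)`. -/
def scaleHom : ℂˣ →* (ℂ ≃ₗ[ℂ] ℂ) where
  toFun := RaoDirectSumDatum.scale ℂ
  map_one' := LinearEquiv.ext fun x => by simp
  map_mul' z w := LinearEquiv.ext fun x => by simp [LinearEquiv.mul_apply, mul_assoc]

/-- (Ported verbatim from the HodgeCMPerL package; no docstring in the source.) -/
theorem scaleHom_apply (z : ℂˣ) : scaleHom z = RaoDirectSumDatum.scale ℂ z := rfl

/-- (Ported verbatim from the HodgeCMPerL package; no docstring in the source.) -/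
theorem scaleHom_injective : Function.Injective scaleHom := by
  intro z w h
  have h1 := LinearEquiv.congr_fun h (1 : ℂ)
  simp only [scaleHom_apply, RaoDirectSumDatum.scale_apply, smul_eq_mul, mul_one] at h1
  exact Units.ext h1

/-- Rao datum: trivial symplectic groups, standard models `ℂ`, `e = lid`, `r = 1`. -/
abbrev R : RaoDirectSumDatum.{0} where
  Sp₁ := PUnit
  Sp₂ := PUnit
  Sp := PUnit
  diag := 1
  T₁ := ℂ
  T₂ := ℂ
  T := ℂ
  e := TensorProduct.lid ℂ ℂ
  r₁ := fun _ => 1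
  r₂ := fun _ => 1
  r := fun _ => 1

/-- (Ported verbatim from the HodgeCMPerL package; no docstring in the source.) -/
theorem R_standardModelTensor : R.StandardModelTensor := by
  intro σ₁ σ₂ x₁ x₂
  rfl

/-- HKS splitting datum: `G(V₃ + V₃⁻) := ℂˣ`, `x = id`, `j = 0`, all Weil indices `1`. -/
abbrev K : HKSSplittingDatum.{0} where
  G := ℂˣ
  Eu := ℂˣ
  Fu := ℂˣ
  x := id
  j := fun _ => 0
  hilbΔ := 1
  γΔ := 1
  γ₁ := 1

/-- The partners `W₁`, `W₂`: characters `χ = id`, so `β_{W_j}(h) = h`. -/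
abbrev P₁ : K.Partner := ⟨1, 1, MonoidHom.id ℂˣ⟩
/-- see `P₁` -/
abbrev P₂ : K.Partner := ⟨2, 1, MonoidHom.id ℂˣ⟩

/-- (Ported verbatim from the HodgeCMPerL package; no docstring in the source.) -/
theorem beta_P₁ (h : ℂˣ) : K.beta P₁ h = h := by
  simp [HKSSplittingDatum.beta, HKSSplittingDatum.gammaRV, K]

/-- (Ported verbatim from the HodgeCMPerL package; no docstring in the source.) -/
theorem beta_P₂ (h : ℂˣ) : K.beta P₂ h = h := by
  simp [HKSSplittingDatum.beta, HKSSplittingDatum.gammaRV, K]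

/-- (Ported verbatim from the HodgeCMPerL package; no docstring in the source.) -/
theorem beta_sum (h : ℂˣ) : K.beta (HKSSplittingDatum.Partner.sum K P₁ P₂) h = h * h := by
  rw [HKSSplittingDatum.beta_sum, beta_P₁, beta_P₂]

/-- The doubled-level data. -/
abbrev D : GUsideDoubledDatum.{0} where
  R := R
  K := K
  P₁ := P₁
  P₂ := P₂
  ι₁ := fun _ => PUnit.unit
  ι₂ := fun _ => PUnit.unit
  ι := fun _ => PUnit.unit

/-- (Ported verbatim from the HodgeCMPerL package; no docstring in the source.) -/
theorem D_iotaDiag : D.IotaDiag := fun _ => rfl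

/-- (Ported verbatim from the HodgeCMPerL package; no docstring in the source.) -/
theorem opOf_R (σ : PUnit) (z : ℂˣ) : R.opOf σ z = scaleHom z := by
  simp only [RaoDirectSumDatum.opOf, R, mul_one]; rfl

/-- (Ported verbatim from the HodgeCMPerL package; no docstring in the source.) -/
theorem opOf₁_R (σ : PUnit) (z : ℂˣ) : R.opOf₁ σ z = scaleHom z := by
  simp only [RaoDirectSumDatum.opOf₁, R, mul_one]; rfl

/-- (Ported verbatim from the HodgeCMPerL package; no docstring in the source.) -/
theorem opOf₂_R (σ : PUnit) (z : ℂˣ) : R.opOf₂ σ z = scaleHom z := by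
  simp only [RaoDirectSumDatum.opOf₂, R, mul_one]; rfl

/-- (Ported verbatim from the HodgeCMPerL package; no docstring in the source.) -/
theorem iotaTilde₁_D (h : ℂˣ) : D.iotaTilde₁ h = scaleHom h := by
  change R.opOf₁ PUnit.unit (K.beta P₁ h) = _
  rw [beta_P₁, opOf₁_R]

/-- (Ported verbatim from the HodgeCMPerL package; no docstring in the source.) -/
theorem iotaTilde₂_D (h : ℂˣ) : D.iotaTilde₂ h = scaleHom h := by
  change R.opOf₂ PUnit.unit (K.beta P₂ h) = _
  rw [beta_P₂, opOf₂_R]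

/-- (Ported verbatim from the HodgeCMPerL package; no docstring in the source.) -/
theorem iotaTilde_D (h : ℂˣ) : D.iotaTilde h = scaleHom (h * h) := by
  change R.opOf PUnit.unit (K.beta (HKSSplittingDatum.Partner.sum K P₁ P₂) h) = _
  rw [beta_sum, opOf_R]

/-- `jOp` of the scalar model is multiplication of scalars. -/
theorem jOp_scaleHom (z₁ z₂ : ℂˣ) : R.jOp (scaleHom z₁, scaleHom z₂) = scaleHom (z₁ * z₂) := by
  rw [← opOf₁_R PUnit.unit, ← opOf₂_R PUnit.unit, R_standardModelTensor.jOp_opOf, opOf_R]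

/-- The Weil product datum: all spaces `ℂ`; `ω(g₁,g₂,h) = h²·`, `ω_j(g_j,h) = h·`; theta kernels = evaluation. -/
abbrev Dw : WeilProductDatum.{0} where
  G₁ := PUnit
  G₂ := PUnit
  H := ℂˣ
  S := ℂ
  S₁ := ℂ
  S₂ := ℂ
  ω := fun _ _ h => (scaleHom (h * h) : ℂ ≃ₗ[ℂ] ℂ)
  ω₁ := fun _ h => (scaleHom h : ℂ ≃ₗ[ℂ] ℂ)
  ω₂ := fun _ h => (scaleHom h : ℂ ≃ₗ[ℂ] ℂ)
  θ := fun x _ _ _ => x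
  θ₁ := fun x _ _ => x
  θ₂ := fun x _ _ => x

/-- The seesaw cover: `Mp(𝕎₁) = Mp(𝕎₂) = Mp(𝕎) := ℂˣ`, `j̃(z₁,z₂) = z₁z₂`, `Ω = scalars`, `U(W)`-side splittings
trivial, `G_U`-side splittings `h ↦ h`, `h ↦ h`, `h ↦ h²`. -/
abbrev C : Dw.SeesawCover where
  G := PUnit
  incl := fun _ _ => PUnit.unit
  M := ℂˣ
  M₁ := ℂˣ
  M₂ := ℂˣ
  jt := (MonoidHom.id ℂˣ).coprod (MonoidHom.id ℂˣ)
  Ω := fun m => (scaleHom m : ℂ ≃ₗ[ℂ] ℂ)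
  Ω₁ := fun m => (scaleHom m : ℂ ≃ₗ[ℂ] ℂ)
  Ω₂ := fun m => (scaleHom m : ℂ ≃ₗ[ℂ] ℂ)
  ιW := fun _ => 1
  ιW₁ := fun _ => 1
  ιW₂ := fun _ => 1
  ιV := fun h => h * h
  ιV₁ := fun h => h
  ιV₂ := fun h => h

/-- (Ported verbatim from the HodgeCMPerL package; no docstring in the source.) -/
theorem C_jt (m₁ m₂ : ℂˣ) : C.jt (m₁, m₂) = m₁ * m₂ := rfl

/-- **Every field of `DoubledModel` holds in the scalar model** (incl. the PRINT-DERIVED `jt_compat`). -/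
def X : C.DoubledModel where
  D := D
  toDouble := id
  κ₁ := scaleHom
  κ₂ := scaleHom
  κ := scaleHom
  κ_injective := scaleHom_injective
  desc₁ := fun h => (iotaTilde₁_D h).symm
  desc₂ := fun h => (iotaTilde₂_D h).symm
  desc := fun h => (iotaTilde_D h).symm
  jt_compat := fun m₁ m₂ => by rw [C_jt, jOp_scaleHom]

/-- The chain's first link fires: `Pending_GUsideCompatible` for `C`. -/
theorem smoke_pending_GUsideCompatible : C.Pending_GUsideCompatible :=
  WeilProductDatum.SeesawCover.pending_GUsideCompatible_of_doubledModel X R_standardModelTensor D_iotaDiag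

/-- (Ported verbatim from the HodgeCMPerL package; no docstring in the source.) -/
theorem C_splittingRestricts : C.toHKSRestrictionDatum.SplittingRestricts := by
  intro g₁ g₂
  change (1 : ℂˣ) = C.jt (1, 1)
  rw [C_jt, one_mul]

/-- (Ported verbatim from the HodgeCMPerL package; no docstring in the source.) -/
theorem C_isPullback : C.IsPullback := by
  refine ⟨fun g₁ g₂ h => ?_, fun g₁ h => ?_, fun g₂ h => ?_⟩
  · change ((scaleHom (h * h) : ℂ ≃ₗ[ℂ] ℂ) : ℂ →ₗ[ℂ] ℂ) = (scaleHom (1 * (h * h)) : ℂ ≃ₗ[ℂ] ℂ)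
    rw [one_mul]
  · change ((scaleHom h : ℂ ≃ₗ[ℂ] ℂ) : ℂ →ₗ[ℂ] ℂ) = (scaleHom (1 * h) : ℂ ≃ₗ[ℂ] ℂ)
    rw [one_mul]
  · change ((scaleHom h : ℂ ≃ₗ[ℂ] ℂ) : ℂ →ₗ[ℂ] ℂ) = (scaleHom (1 * h) : ℂ ≃ₗ[ℂ] ℂ)
    rw [one_mul]

/-- Kudla's tensor compatibility `hKu` in the scalar model: `(m₁x₁)(m₂x₂) = m₁m₂ · x₁x₂`. -/
theorem C_hKu (m₁ m₂ : ℂˣ) (x₁ x₂ : ℂ) :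
    TensorProduct.lid ℂ ℂ (C.Ω₁ m₁ x₁ ⊗ₜ[ℂ] C.Ω₂ m₂ x₂) =
      C.Ω (C.jt (m₁, m₂)) (TensorProduct.lid ℂ ℂ (x₁ ⊗ₜ[ℂ] x₂)) := by
  change TensorProduct.lid ℂ ℂ (scaleHom m₁ x₁ ⊗ₜ[ℂ] scaleHom m₂ x₂) =
    scaleHom (m₁ * m₂) (TensorProduct.lid ℂ ℂ (x₁ ⊗ₜ[ℂ] x₂))
  simp only [scaleHom_apply, RaoDirectSumDatum.scale_apply, TensorProduct.lid_tmul, smul_eq_mul,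
    Units.val_mul]
  ring

/-- (Ported verbatim from the HodgeCMPerL package; no docstring in the source.) -/
theorem C_hθ (x₁ x₂ : ℂ) (h : ℂˣ) (g₁ g₂ : PUnit) :
    Dw.θ (TensorProduct.lid ℂ ℂ (x₁ ⊗ₜ[ℂ] x₂)) h g₁ g₂ = Dw.θ₁ x₁ h g₁ * Dw.θ₂ x₂ h g₂ := by
  change TensorProduct.lid ℂ ℂ (x₁ ⊗ₜ[ℂ] x₂) = x₁ * x₂
  rw [TensorProduct.lid_tmul, smul_eq_mul]

/-- **The whole chain fires:** PerL's seesaw statement `Pending_unitaryWeilRepMultiplicative` holds for `Dw`,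
obtained ONLY through `of_parts` ∘ `splittingsCompatible_of` ∘ `pending_GUsideCompatible_of_doubledModel`. -/
theorem smoke_unitaryWeilRepMultiplicative : Dw.Pending_unitaryWeilRepMultiplicative :=
  WeilProductDatum.SeesawCover.of_parts C_isPullback
    (WeilProductDatum.SeesawCover.splittingsCompatible_of C_splittingRestricts smoke_pending_GUsideCompatible)
    (TensorProduct.lid ℂ ℂ) C_hKu C_hθ

/-- Non-degeneracy: the `G_U`-side of the model is not trivial (`ι̃_{W,μ₁μ₂}(h) = h² ≠ 1` for `h = 2`). -/
example : C.ιV (Units.mk0 (2 : ℂ) two_ne_zero) ≠ 1 := by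
  intro h
  have h2 := congrArg (fun u : ℂˣ => (u : ℂ)) h
  change ((Units.mk0 (2 : ℂ) two_ne_zero * Units.mk0 (2 : ℂ) two_ne_zero : ℂˣ) : ℂ) = ((1 : ℂˣ) : ℂ) at h2
  rw [Units.val_mul, Units.val_mk0, Units.val_one] at h2
  norm_num at h2

end HodgeCM.Automorphic.ThetaPending.SeesawSmoke

end
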